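import Literature.NumberTheory.LFunctions.DirichletLFunctionBounds
import Literature.NumberTheory.LFunctions.PrimeReciprocalWindows
import Literature.NumberTheory.LFunctions.MertensElementary
import Mathlib.NumberTheory.SumPrimeReciprocals
import Mathlib.Analysis.InnerProductSpace.Calculus
import Mathlib.NumberTheory.EulerProduct.DirichletLSeries
import Mathlib.NumberTheory.LSeries.Nonvanishing
import HarnessLib

/-!
# Truncated Euler products at `1`: `∏_{p < z} (1 − χ(p)/p) ≪_τ L(1, χ)⁻¹` for `z ≥ q^τ`

Topic `Literature/NumberTheory/LFunctions`. Everything in this file is PROVED (theorems only).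

For a non-principal Dirichlet character `χ` modulo `q` the Euler product of `L(1, χ)` converges
only conditionally, and the comparison of `L(1, χ)` with its truncation `∏_{p < z}(1 − χ(p)/p)⁻¹`
at `z = q^τ` is a statement about the zeros of `L(s, χ)` near `s = 1`. ONE direction is
unconditional and uniform — the possible exceptional (Siegel) zero only helps — and is the
analytic input of Granville–Mollin's uniform upper bound for prime values of quadratic
polynomials (*Rabinowitsch revisited*, Acta Arith. 96 (2000), Theorem 1; there (5.3)–(5.4) via
the explicit formula). We prove it from the local partial-fraction decomposition of `L'/L`
(Montgomery–Vaughan Lemma 11.1, the tree's `Literature.NumberTheory.LFunctions.DirichletZFR.exists_logDeriv_package`):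

* `exists_re_logDeriv_ge` — **one-sided bound on the real axis**: there is an absolute `E` with
  `Re L'/L(σ, χ) ≥ −E (log q + log 4)` for `χ ≠ χ₀` and `1 < σ ≤ 9/8`
  (each zero `ρ` contributes `Re 1/(σ − ρ) > 0`);
* `exists_norm_LFunction_one_le` — integrating, `|L(1, χ)| ≤ |L(σ, χ)| e^{E(log q + log 4)(σ − 1)}`
  for `1 ≤ σ ≤ 9/8`;
* `log_norm_LFunction_le_tsum_re` — `log |L(σ, χ)| ≤ ∑_p Re χ(p) p^{−σ} + 2` for `σ > 1`
  (Euler product);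
* `sum_Ico_prime_rpow_le`, `tsum_tail_prime_rpow_le` — Chebyshev: `∑_{p ≥ M} p^{−1−1/log M} ≤ 16`
  (`M ≥ 16`); `sum_primesBelow_inv_sub_rpow_le` — Mertens: `∑_{p<M} (1/p − p^{−1−1/log M}) ≤ 1 + log 4/log M`;
* `exists_prod_one_sub_re_div_le` — **the truncated product bound**: there is an absolute `C` such
  that for `χ ≠ χ₀` mod `q`, `0 < τ ≤ 1` and every `M ≥ e^8` with `M ≥ q^τ`,
  `∏_{p < M} (1 − Re χ(p)/p) ≤ e^{C/τ} / |L(1, χ)|`.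

## References

* A. Granville, R. A. Mollin, *Rabinowitsch revisited*, Acta Arith. 96 (2000), 139–153, §5,
  (5.3)–(5.4) [GranvilleMollin2000].
* H. L. Montgomery, R. C. Vaughan, *Multiplicative Number Theory I*, CUP (2007), Lemma 11.1,
  §4.3 (Mertens-type estimates for `L(1, χ)`) [MontgomeryVaughan2007].
-/

noncomputable section

open Complex Filter Topology Metric Set Finset
open scoped LSeries.notation

namespace Literature.NumberTheory.LFunctions.DirichletLOne

/-! ### A. One-sided bound for `Re L'/L(σ, χ)`, `σ > 1` real -/

/-- **`Re L'/L(σ, χ) ≥ −E(log q + log 4)` for `1 < σ ≤ 9/8`.** From MV Lemma 11.1 at height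
`t = 0`: `L'/L(σ) = ∑_ρ m(ρ)/(σ − ρ) + ψ(σ)` with `|ψ(σ)| ≤ E(log q + log 4)` on
`|σ − 17/16| ≤ 13/128`, and every zero has `Re ρ < 1 < σ`, so `Re (σ − ρ)⁻¹ > 0`. The exceptional
zero, if any, only increases `Re L'/L(σ)`. [cite: MontgomeryVaughan2007, Lemma 11.1] -/
theorem exists_re_logDeriv_ge :
    ∃ E : ℝ, 0 ≤ E ∧ ∀ (q : ℕ) [NeZero q] (χ : DirichletCharacter ℂ q), χ ≠ 1 →
      ∀ σ : ℝ, 1 < σ → σ ≤ 9 / 8 →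
        -(E * (Real.log q + Real.log 4)) ≤
          (deriv χ.LFunction (σ : ℂ) / χ.LFunction (σ : ℂ)).re := by
  obtain ⟨E, hE, hpack⟩ := Literature.NumberTheory.LFunctions.DirichletZFR.exists_logDeriv_package
  refine ⟨E, hE, fun q _ χ hχ σ hσ1 hσ2 => ?_⟩
  obtain ⟨S, m, ψ, hS, -, hψ, hψb⟩ := hpack q χ hχ 0
  have hc : (17 / 16 + (0 : ℝ) * I : ℂ) = (17 / 16 : ℂ) := by simp
  simp only [hc] at hS hψ hψb
  have hdist : ‖(σ : ℂ) - 17 / 16‖ ≤ 13 / 128 := by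
    rw [show (σ : ℂ) - 17 / 16 = ((σ - 17 / 16 : ℝ) : ℂ) by push_cast; ring, Complex.norm_real,
      Real.norm_eq_abs, abs_le]
    constructor <;> linarith
  have hball : (σ : ℂ) ∈ ball (17 / 16 : ℂ) (13 / 32) := mem_ball_iff_norm.2 (by linarith)
  have hcl : (σ : ℂ) ∈ closedBall (17 / 16 : ℂ) (13 / 128) := mem_closedBall_iff_norm.2 hdist
  have hL : χ.LFunction (σ : ℂ) ≠ 0 :=
    DirichletCharacter.LFunction_ne_zero_of_one_le_re χ (Or.inl hχ) (by simp; linarith)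
  have hψσ := hψ (σ : ℂ) hball hL
  have hEq : deriv χ.LFunction (σ : ℂ) / χ.LFunction (σ : ℂ) =
      ψ σ + ∑ a ∈ S, (m a : ℂ) / ((σ : ℂ) - a) := by rw [hψσ]; ring
  rw [hEq, Complex.add_re, Complex.re_sum]
  have h1 : -(E * (Real.log q + Real.log 4)) ≤ (ψ σ).re := by
    have hb := hψb (σ : ℂ) hcl
    simp only [abs_zero, zero_add] at hb
    have := Complex.abs_re_le_norm (ψ σ)
    rw [abs_le] at this
    linarith [this.1]
  have h2 : 0 ≤ ∑ a ∈ S, ((m a : ℂ) / ((σ : ℂ) - a)).re := by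
    refine Finset.sum_nonneg fun a ha => ?_
    obtain ⟨hLa, -, -⟩ := hS a ha
    have hare : a.re < 1 := by
      by_contra hcon
      exact DirichletCharacter.LFunction_ne_zero_of_one_le_re χ (Or.inl hχ) (not_lt.1 hcon) hLa
    have hre : ((m a : ℂ) / ((σ : ℂ) - a)).re = (m a : ℝ) * (((σ : ℂ) - a)⁻¹).re := by
      rw [div_eq_mul_inv, show ((m a : ℕ) : ℂ) = ((m a : ℝ) : ℂ) by simp, Complex.re_ofReal_mul]
    rw [hre]
    refine mul_nonneg (Nat.cast_nonneg _) ?_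
    rw [Complex.inv_re]
    refine div_nonneg ?_ (Complex.normSq_nonneg _)
    simp only [Complex.sub_re, Complex.ofReal_re]
    linarith
  linarith

/-! ### B. `|L(1, χ)| ≤ |L(σ, χ)| e^{Eℒ(σ − 1)}` -/

/-- The real-variable restriction `u ↦ L(u, χ)` has derivative `L'(u, χ)`. [folklore] -/
theorem hasDerivAt_LFunction_ofReal {q : ℕ} [NeZero q] (χ : DirichletCharacter ℂ q) (hχ : χ ≠ 1)
    (u : ℝ) : HasDerivAt (fun x : ℝ => χ.LFunction (x : ℂ)) (deriv χ.LFunction (u : ℂ)) u :=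
  HasDerivAt.comp_ofReal (DirichletCharacter.differentiable_LFunction hχ (u : ℂ)).hasDerivAt

/-- Derivative of `u ↦ |L(u, χ)|²`: `2 Re(L'(u) conj L(u)) = 2 Re(L'/L(u)) |L(u)|²`. [folklore] -/
theorem hasDerivAt_normSq_LFunction {q : ℕ} [NeZero q] (χ : DirichletCharacter ℂ q) (hχ : χ ≠ 1)
    (u : ℝ) :
    HasDerivAt (fun x : ℝ => ‖χ.LFunction (x : ℂ)‖ ^ 2)
      (2 * ((deriv χ.LFunction (u : ℂ)) * (starRingEnd ℂ) (χ.LFunction (u : ℂ))).re) u := by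
  have h := (hasDerivAt_LFunction_ofReal χ hχ u).norm_sq
  rw [Complex.inner] at h
  exact h

/-- **`|L(1, χ)| ≤ |L(σ, χ)| · exp(E (log q + log 4)(σ − 1))` for `1 ≤ σ ≤ 9/8`** (`E` the
absolute constant of `exists_re_logDeriv_ge`): the function
`u ↦ e^{2Eℒu} |L(u, χ)|²` has derivative `2 e^{2Eℒu} |L|² (Eℒ + Re L'/L) ≥ 0` on `(1, 9/8)`, hence is
monotone on `[1, 9/8]`. This is the unconditional half of `L(1, χ) ≍ L(1 + 1/log q^τ, χ)`.
[cite: GranvilleMollin2000, §5B–5C (5.3)–(5.4)] -/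
theorem exists_norm_LFunction_one_le :
    ∃ E : ℝ, 0 ≤ E ∧ ∀ (q : ℕ) [NeZero q] (χ : DirichletCharacter ℂ q), χ ≠ 1 →
      ∀ σ : ℝ, 1 ≤ σ → σ ≤ 9 / 8 →
        ‖χ.LFunction 1‖ ≤ ‖χ.LFunction (σ : ℂ)‖ *
          Real.exp (E * (Real.log q + Real.log 4) * (σ - 1)) := by
  obtain ⟨E, hE, hA⟩ := exists_re_logDeriv_ge
  refine ⟨E, hE, fun q _ χ hχ σ hσ1 hσ2 => ?_⟩
  set ℒ : ℝ := Real.log q + Real.log 4 with hℒ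
  -- derivative of `H(u) = e^{2Eℒu} |L(u)|²`
  have hHd : ∀ u : ℝ, HasDerivAt (fun x : ℝ => Real.exp (2 * (E * ℒ) * x) * ‖χ.LFunction (x : ℂ)‖ ^ 2)
      (Real.exp (2 * (E * ℒ) * u) * (2 * (E * ℒ)) * ‖χ.LFunction (u : ℂ)‖ ^ 2 +
        Real.exp (2 * (E * ℒ) * u) *
          (2 * ((deriv χ.LFunction (u : ℂ)) * (starRingEnd ℂ) (χ.LFunction (u : ℂ))).re)) u := by
    intro u
    have h1 : HasDerivAt (fun x : ℝ => Real.exp (2 * (E * ℒ) * x))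
        (Real.exp (2 * (E * ℒ) * u) * (2 * (E * ℒ))) u := by
      have := ((hasDerivAt_id u).const_mul (2 * (E * ℒ))).exp
      simpa using this
    exact h1.mul (hasDerivAt_normSq_LFunction χ hχ u)
  -- monotone on `[1, 9/8]`
  have hmono : MonotoneOn (fun x : ℝ => Real.exp (2 * (E * ℒ) * x) * ‖χ.LFunction (x : ℂ)‖ ^ 2)
      (Icc 1 (9 / 8)) := by
    refine monotoneOn_of_deriv_nonneg (convex_Icc _ _) ?_ ?_ ?_
    · exact HasDerivAt.continuousOn fun u _ => hHd u
    · intro u _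
      exact (hHd u).differentiableAt.differentiableWithinAt
    · intro u hu
      rw [interior_Icc] at hu
      rw [(hHd u).deriv]
      have hL : χ.LFunction (u : ℂ) ≠ 0 :=
        DirichletCharacter.LFunction_ne_zero_of_one_le_re χ (Or.inl hχ) (by simp; linarith [hu.1])
      have hre : ((deriv χ.LFunction (u : ℂ)) * (starRingEnd ℂ) (χ.LFunction (u : ℂ))).re =
          (deriv χ.LFunction (u : ℂ) / χ.LFunction (u : ℂ)).re * ‖χ.LFunction (u : ℂ)‖ ^ 2 := by
        have : (deriv χ.LFunction (u : ℂ)) * (starRingEnd ℂ) (χ.LFunction (u : ℂ)) =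
            (deriv χ.LFunction (u : ℂ) / χ.LFunction (u : ℂ)) * ((‖χ.LFunction (u : ℂ)‖ ^ 2 : ℝ) : ℂ) := by
          rw [← Complex.normSq_eq_norm_sq, Complex.normSq_eq_conj_mul_self]
          field_simp
        rw [this, Complex.re_mul_ofReal]
      rw [hre]
      have hA' := hA q χ hχ u hu.1 hu.2.le
      have key : 0 ≤ E * ℒ + (deriv χ.LFunction (u : ℂ) / χ.LFunction (u : ℂ)).re := by linarith
      have : Real.exp (2 * (E * ℒ) * u) * (2 * (E * ℒ)) * ‖χ.LFunction (u : ℂ)‖ ^ 2 +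
          Real.exp (2 * (E * ℒ) * u) *
            (2 * ((deriv χ.LFunction (u : ℂ) / χ.LFunction (u : ℂ)).re * ‖χ.LFunction (u : ℂ)‖ ^ 2)) =
          2 * Real.exp (2 * (E * ℒ) * u) * ‖χ.LFunction (u : ℂ)‖ ^ 2 *
            (E * ℒ + (deriv χ.LFunction (u : ℂ) / χ.LFunction (u : ℂ)).re) := by ring
      rw [this]
      positivity
  have h1σ : Real.exp (2 * (E * ℒ) * 1) * ‖χ.LFunction ((1 : ℝ) : ℂ)‖ ^ 2 ≤
      Real.exp (2 * (E * ℒ) * σ) * ‖χ.LFunction (σ : ℂ)‖ ^ 2 :=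
    hmono (left_mem_Icc.2 (by norm_num)) ⟨hσ1, hσ2⟩ hσ1
  rw [Complex.ofReal_one] at h1σ
  -- `|L(1)|² ≤ (|L(σ)| e^{Eℒ(σ-1)})²`
  have hexp1 : 0 < Real.exp (2 * (E * ℒ) * 1) := Real.exp_pos _
  have hsq : ‖χ.LFunction 1‖ ^ 2 ≤ (‖χ.LFunction (σ : ℂ)‖ * Real.exp (E * ℒ * (σ - 1))) ^ 2 := by
    have e1 : (‖χ.LFunction (σ : ℂ)‖ * Real.exp (E * ℒ * (σ - 1))) ^ 2 =
        Real.exp (2 * (E * ℒ) * σ) * ‖χ.LFunction (σ : ℂ)‖ ^ 2 / Real.exp (2 * (E * ℒ) * 1) := by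
      rw [mul_pow, ← Real.exp_nat_mul,
        show ((2 : ℕ) : ℝ) * (E * ℒ * (σ - 1)) = 2 * (E * ℒ) * σ - 2 * (E * ℒ) * 1 by push_cast; ring,
        Real.exp_sub]
      ring
    rw [e1, le_div_iff₀ hexp1]
    linarith
  exact (pow_le_pow_iff_left₀ (norm_nonneg _) (by positivity) two_ne_zero).1 hsq

/-! ### C1. `log |L(σ, χ)| ≤ ∑_p Re χ(p) p^{-σ} + 2` (`σ > 1`) -/

/-- The Euler-factor weights `χ(p) p^{-σ}` are absolutely summable over the primes for `σ > 1`,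
with `|χ(p) p^{-σ}| ≤ p^{-σ}`. [folklore] -/
theorem summable_primes_mul_cpow {q : ℕ} (χ : DirichletCharacter ℂ q) {σ : ℝ} (hσ : 1 < σ) :
    Summable fun p : Nat.Primes => χ p * (p : ℂ) ^ (-(σ : ℂ)) := by
  refine Summable.of_norm_bounded (g := fun p : Nat.Primes => (p : ℝ) ^ (-σ))
    (Nat.Primes.summable_rpow.2 (by linarith)) fun p => ?_
  rw [norm_mul, Complex.norm_natCast_cpow_of_pos p.prop.pos]
  simp only [Complex.neg_re, Complex.ofReal_re]
  exact mul_le_of_le_one_left (Real.rpow_nonneg (Nat.cast_nonneg _) _)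
    (DirichletCharacter.norm_le_one χ _)

/-- For `|w| ≤ 1/2`: `Re(−log(1 − w)) ≤ Re w + |w|²` (`|−log(1−w) − w| ≤ |w|²/(2(1−|w|)) ≤ |w|²`).
[folklore] -/
theorem re_neg_log_one_sub_le {w : ℂ} (hw : ‖w‖ ≤ 1 / 2) :
    (-Complex.log (1 - w)).re ≤ w.re + ‖w‖ ^ 2 := by
  have hw1 : ‖w‖ < 1 := by linarith
  have harg : (1 - w).arg ≠ Real.pi := by
    rw [Ne, Complex.arg_eq_pi_iff, not_and_or]
    left
    have : (1 - w).re = 1 - w.re := by simp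
    have h2 := Complex.abs_re_le_norm w
    rw [abs_le] at h2
    linarith [h2.2]
  have hlog : -Complex.log (1 - w) = Complex.log (1 - w)⁻¹ := (Complex.log_inv _ harg).symm
  have hb := Complex.norm_log_one_sub_inv_sub_self_le hw1
  have hb' : ‖Complex.log (1 - w)⁻¹ - w‖ ≤ ‖w‖ ^ 2 := by
    refine hb.trans ?_
    have h1 : (1 - ‖w‖)⁻¹ ≤ 2 := by
      rw [inv_le_comm₀ (by linarith) two_pos]; linarith
    have h0 : 0 ≤ ‖w‖ ^ 2 := sq_nonneg _
    calc ‖w‖ ^ 2 * (1 - ‖w‖)⁻¹ / 2 ≤ ‖w‖ ^ 2 * 2 / 2 := by gcongr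
      _ = ‖w‖ ^ 2 := by ring
  have hre : (Complex.log (1 - w)⁻¹ - w).re ≤ ‖w‖ ^ 2 :=
    (Complex.re_le_norm _).trans hb'
  rw [hlog]
  have : (Complex.log (1 - w)⁻¹).re = w.re + (Complex.log (1 - w)⁻¹ - w).re := by simp
  rw [this]
  linarith

/-- `∑_p p^{-2} ≤ 2` (indeed `≤ π²/6 − 1`). [folklore] -/
theorem tsum_primes_rpow_neg_two_le : ∑' p : Nat.Primes, ((p : ℕ) : ℝ) ^ (-2 : ℝ) ≤ 2 := by
  have hf : ∀ n : ℕ, (n : ℝ) ^ (-2 : ℝ) = 1 / (n : ℝ) ^ 2 := by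
    intro n
    rw [Real.rpow_neg (Nat.cast_nonneg n), one_div, show (2 : ℝ) = ((2 : ℕ) : ℝ) by norm_num,
      Real.rpow_natCast]
  have hs : Summable fun n : ℕ => (n : ℝ) ^ (-2 : ℝ) := by
    simp_rw [hf]; exact hasSum_zeta_two.summable
  calc ∑' p : Nat.Primes, ((p : ℕ) : ℝ) ^ (-2 : ℝ)
      ≤ ∑' n : ℕ, (n : ℝ) ^ (-2 : ℝ) :=
        Summable.tsum_subtype_le (fun n : ℕ => (n : ℝ) ^ (-2 : ℝ)) {p | p.Prime}
          (fun n => Real.rpow_nonneg (Nat.cast_nonneg n) _) hs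
    _ = Real.pi ^ 2 / 6 := by simp_rw [hf]; exact hasSum_zeta_two.tsum_eq
    _ ≤ 2 := by
        have := Real.pi_lt_d2
        have h0 : 0 < Real.pi := Real.pi_pos
        nlinarith

/-- **`log |L(σ, χ)| ≤ ∑_p Re(χ(p) p^{−σ}) + 2` for real `σ > 1`** (logarithm of the Euler
product, `Re(−log(1 − w)) ≤ Re w + |w|²` and `∑_p p^{−2} ≤ 2`). [folklore] -/
theorem log_norm_LFunction_le_tsum_re {q : ℕ} [NeZero q] (χ : DirichletCharacter ℂ q) {σ : ℝ}
    (hσ : 1 < σ) :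
    Real.log ‖χ.LFunction (σ : ℂ)‖ ≤
      ∑' p : Nat.Primes, (χ p * (p : ℂ) ^ (-(σ : ℂ))).re + 2 := by
  have hs : 1 < (σ : ℂ).re := by simp [hσ]
  set w : Nat.Primes → ℂ := fun p => χ p * (p : ℂ) ^ (-(σ : ℂ)) with hw
  have hwsum : Summable w := summable_primes_mul_cpow χ hσ
  have hwnorm : ∀ p : Nat.Primes, ‖w p‖ ≤ ((p : ℕ) : ℝ) ^ (-σ) := by
    intro p
    rw [hw, norm_mul, Complex.norm_natCast_cpow_of_pos p.prop.pos]
    simp only [Complex.neg_re, Complex.ofReal_re]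
    exact mul_le_of_le_one_left (Real.rpow_nonneg (Nat.cast_nonneg _) _)
      (DirichletCharacter.norm_le_one χ _)
  have hp2 : ∀ p : Nat.Primes, (2 : ℝ) ≤ ((p : ℕ) : ℝ) := fun p => by exact_mod_cast p.prop.two_le
  have hwhalf : ∀ p : Nat.Primes, ‖w p‖ ≤ 1 / 2 := by
    intro p
    refine (hwnorm p).trans ?_
    calc ((p : ℕ) : ℝ) ^ (-σ) ≤ ((p : ℕ) : ℝ) ^ (-1 : ℝ) :=
          Real.rpow_le_rpow_of_exponent_le (by linarith [hp2 p]) (by linarith)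
      _ = 1 / (p : ℝ) := by rw [Real.rpow_neg_one, one_div]
      _ ≤ 1 / 2 := by gcongr; exact hp2 p
  have hwsq : ∀ p : Nat.Primes, ‖w p‖ ^ 2 ≤ ((p : ℕ) : ℝ) ^ (-2 : ℝ) := by
    intro p
    have h1 : ‖w p‖ ≤ ((p : ℕ) : ℝ) ^ (-1 : ℝ) :=
      (hwnorm p).trans (Real.rpow_le_rpow_of_exponent_le (by linarith [hp2 p]) (by linarith))
    calc ‖w p‖ ^ 2 ≤ (((p : ℕ) : ℝ) ^ (-1 : ℝ)) ^ 2 := by gcongr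
      _ = ((p : ℕ) : ℝ) ^ (-2 : ℝ) := by
          rw [← Real.rpow_natCast, ← Real.rpow_mul (by linarith [hp2 p])]; norm_num
  -- `|L(σ)| = exp(Re ∑ -log(1 - w_p))`
  have hL : Complex.exp (∑' p : Nat.Primes, -Complex.log (1 - w p)) = χ.LFunction (σ : ℂ) := by
    rw [DirichletCharacter.LFunction_eq_LSeries χ hs]
    exact DirichletCharacter.LSeries_eulerProduct_exp_log χ hs
  have hlogsum : Summable fun p : Nat.Primes => -Complex.log (1 - w p) := hwsum.clog_one_sub.neg
  rw [← hL, Complex.norm_exp, Real.log_exp, Complex.re_tsum hlogsum]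
  -- termwise bound
  have hre_w : Summable fun p : Nat.Primes => (w p).re := Complex.reCLM.summable hwsum
  have hsq_s : Summable fun p : Nat.Primes => ((p : ℕ) : ℝ) ^ (-2 : ℝ) :=
    Nat.Primes.summable_rpow.2 (by norm_num)
  have hre_l : Summable fun p : Nat.Primes => (-Complex.log (1 - w p)).re :=
    Complex.reCLM.summable hlogsum
  calc ∑' p : Nat.Primes, (-Complex.log (1 - w p)).re
      ≤ ∑' p : Nat.Primes, ((w p).re + ((p : ℕ) : ℝ) ^ (-2 : ℝ)) :=
        Summable.tsum_le_tsum (fun p => (re_neg_log_one_sub_le (hwhalf p)).trans (by linarith [hwsq p]))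
          hre_l (hre_w.add hsq_s)
    _ = ∑' p : Nat.Primes, (w p).re + ∑' p : Nat.Primes, ((p : ℕ) : ℝ) ^ (-2 : ℝ) :=
        Summable.tsum_add hre_w hsq_s
    _ ≤ ∑' p : Nat.Primes, (w p).re + 2 := by linarith [tsum_primes_rpow_neg_two_le]

/-! ### C2. The head: `∑_{p < M} (1/p − p^{−1−1/log M}) ≤ 1 + log 4/log M` -/

/-- `1/p − p^{−1−ε} = (1 − e^{−ε log p})/p ≤ ε log p/p` (`p ≥ 1`; from `1 − e^{−a} ≤ a`). [folklore] -/
theorem inv_sub_rpow_le {p : ℝ} (hp : 1 ≤ p) (ε : ℝ) :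
    1 / p - p ^ (-(1 + ε)) ≤ ε * (Real.log p / p) := by
  have hp0 : 0 < p := by linarith
  have h1 : p ^ (-(1 + ε)) = (1 / p) * Real.exp (-(ε * Real.log p)) := by
    rw [Real.rpow_def_of_pos hp0, show Real.log p * -(1 + ε) = -Real.log p + -(ε * Real.log p) by ring,
      Real.exp_add, Real.exp_neg, Real.exp_log hp0, one_div]
  rw [h1, show 1 / p - 1 / p * Real.exp (-(ε * Real.log p)) = (1 / p) * (1 - Real.exp (-(ε * Real.log p)))
    by ring]
  have h2 := PrimeReciprocal.one_sub_exp_neg_le (ε * Real.log p)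
  calc 1 / p * (1 - Real.exp (-(ε * Real.log p))) ≤ 1 / p * (ε * Real.log p) :=
        mul_le_mul_of_nonneg_left h2 (by positivity)
    _ = ε * (Real.log p / p) := by ring

/-- **The head of the comparison** (Mertens' first theorem, upper half): for `M ≥ 2`,
`∑_{p < M} (1/p − p^{−1−1/log M}) ≤ (log M + log 4)/log M = 1 + log 4/log M`. [folklore] -/
theorem sum_primesBelow_inv_sub_rpow_le {M : ℕ} (hM : 2 ≤ M) :
    ∑ p ∈ Nat.primesBelow M, (1 / (p : ℝ) - (p : ℝ) ^ (-(1 + 1 / Real.log M))) ≤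
      1 + Real.log 4 / Real.log M := by
  have hM1 : (1 : ℝ) < M := by exact_mod_cast hM
  have hlogM : 0 < Real.log M := Real.log_pos hM1
  have hε : 0 ≤ 1 / Real.log M := by positivity
  calc ∑ p ∈ Nat.primesBelow M, (1 / (p : ℝ) - (p : ℝ) ^ (-(1 + 1 / Real.log M)))
      ≤ ∑ p ∈ Nat.primesBelow M, (1 / Real.log M) * (Real.log p / p) := by
        refine Finset.sum_le_sum fun p hp => inv_sub_rpow_le ?_ _
        exact_mod_cast (Nat.mem_primesBelow.1 hp).2.one_lt.le
    _ = (1 / Real.log M) * ∑ p ∈ Nat.primesBelow M, Real.log p / p := by rw [Finset.mul_sum]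
    _ ≤ (1 / Real.log M) * ∑ p ∈ Nat.primesLE M, Real.log p / p := by
        refine mul_le_mul_of_nonneg_left (Finset.sum_le_sum_of_subset_of_nonneg ?_ ?_) hε
        · intro p hp
          rw [Nat.mem_primesBelow] at hp
          exact Nat.mem_primesLE.2 ⟨hp.1.le, hp.2⟩
        · intro p hp _
          have : (1 : ℝ) ≤ p := by exact_mod_cast (Nat.mem_primesLE.1 hp).2.one_lt.le
          exact div_nonneg (Real.log_nonneg this) (by linarith)
    _ ≤ (1 / Real.log M) * (Real.log M + Real.log 4) :=
        mul_le_mul_of_nonneg_left (MertensBound.sum_log_div_prime_le M) hε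
    _ = 1 + Real.log 4 / Real.log M := by field_simp

/-! ### C3. The tail: `∑_{p ≥ M} p^{−1−1/log M} ≤ 16` (Chebyshev over dyadic blocks) -/

/-- **Chebyshev-strength tail bound.** For `M ≥ 16` and every `K`,
`∑_{M ≤ p < K} p^{−1−1/log M} ≤ 16`: over the dyadic block `(2^j, 2^{j+1}]` the sum is
`≤ 2^{−j/log M} · 4/j` (`Literature.NumberTheory.LFunctions.PrimeReciprocal.sum_blockPrimes_inv_le`), and the geometric series
over `j ≥ log₂ M − 1` is `≤ (4/J) · 2 log M/log 2 ≤ 10`. [folklore] -/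
theorem sum_Ico_prime_rpow_le {M : ℕ} (hM : 16 ≤ M) (K : ℕ) :
    ∑ n ∈ (Finset.Ico M K).filter Nat.Prime, (n : ℝ) ^ (-(1 + 1 / Real.log M)) ≤ 16 := by
  have hl2 : (0.6931471803 : ℝ) < Real.log 2 := Real.log_two_gt_d9
  have hlog2 : 0 < Real.log 2 := by linarith
  have hM1 : (1 : ℝ) < M := by exact_mod_cast (show 1 < M by omega)
  have hM0 : (0 : ℝ) < M := by linarith
  have hlogM : 0 < Real.log M := Real.log_pos hM1
  have hlogM4 : 4 * Real.log 2 ≤ Real.log M := by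
    rw [← Real.log_rpow two_pos, show (2 : ℝ) ^ (4 : ℝ) = 16 by norm_num]
    exact Real.log_le_log (by norm_num) (by exact_mod_cast hM)
  set ε : ℝ := 1 / Real.log M with hε
  have hε0 : 0 < ε := by positivity
  have hεlog : ε * Real.log 2 ≤ 1 := by
    rw [hε, one_div_mul_eq_div, div_le_one hlogM]; linarith
  set f : ℕ → ℝ := fun n => if n.Prime then (n : ℝ) ^ (-(1 + ε)) else 0 with hf
  have hf0 : ∀ n, ¬ n.Prime → f n = 0 := fun n hn => by simp [hf, hn]
  have hfnn : ∀ n, 0 ≤ f n := fun n => by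
    simp only [hf]; split_ifs
    · exact Real.rpow_nonneg (Nat.cast_nonneg n) _
    · exact le_rfl
  -- dyadic parameters
  set J := Nat.log 2 M with hJ
  have hJ4 : 4 ≤ J := Nat.le_log_of_pow_le one_lt_two (by norm_num; omega)
  have h2J : 2 ^ J ≤ M := Nat.pow_log_le_self 2 (by omega)
  have hM2J : M < 2 ^ (J + 1) := Nat.lt_pow_succ_log_self one_lt_two M
  set B := Nat.log 2 (M + K) + 1 with hB
  have hMKB : M + K < 2 ^ B := Nat.lt_pow_succ_log_self one_lt_two (M + K)
  have hJB : J ≤ B := by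
    have : J ≤ Nat.log 2 (M + K) := Nat.log_mono_right (Nat.le_add_right M K)
    omega
  -- the sum is dominated by the sum of `f` over `(2^J, 2^B]`
  have step1 : ∑ n ∈ (Finset.Ico M K).filter Nat.Prime, (n : ℝ) ^ (-(1 + ε)) ≤
      ∑ n ∈ Finset.Ioc (2 ^ J) (2 ^ B), f n := by
    have heq : ∑ n ∈ (Finset.Ico M K).filter Nat.Prime, (n : ℝ) ^ (-(1 + ε)) =
        ∑ n ∈ (Finset.Ico M K).filter Nat.Prime, f n := by
      refine Finset.sum_congr rfl fun n hn => ?_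
      rw [hf]; simp [(Finset.mem_filter.1 hn).2]
    rw [heq]
    refine Finset.sum_le_sum_of_subset_of_nonneg (fun n hn => ?_) (fun n _ _ => hfnn n)
    rw [Finset.mem_filter, Finset.mem_Ico] at hn
    obtain ⟨⟨hMn, hnK⟩, hnp⟩ := hn
    rw [Finset.mem_Ioc]
    refine ⟨lt_of_le_of_ne (h2J.trans hMn) fun h => ?_, by omega⟩
    -- `n = 2^J` is not prime (`J ≥ 4`)
    have h2n : 2 ∣ n := by rw [← h]; exact dvd_pow_self 2 (by omega)
    have := (Nat.prime_dvd_prime_iff_eq Nat.prime_two hnp).1 h2n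
    rw [← this] at h
    have : 2 ^ 4 ≤ 2 ^ J := Nat.pow_le_pow_right two_pos hJ4
    omega
  -- block decomposition and blockwise bound
  rw [PrimeReciprocal.sum_Ioc_pow_eq_sum_blocks hf0 hJB] at step1
  set r : ℝ := Real.exp (-(ε * Real.log 2)) with hr
  have hr0 : 0 ≤ r := (Real.exp_pos _).le
  have hr1 : r < 1 := by
    rw [hr, Real.exp_lt_one_iff]
    have : 0 < ε * Real.log 2 := mul_pos hε0 hlog2
    linarith
  have hblock : ∀ j ∈ Finset.Ico J B, ∑ p ∈ PrimeReciprocal.blockPrimes j, f p ≤ (4 / J) * r ^ j := by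
    intro j hj
    have hJj : J ≤ j := (Finset.mem_Ico.1 hj).1
    have hj1 : 1 ≤ j := le_trans (by omega) hJj
    have hj0 : (0 : ℝ) < j := by exact_mod_cast (show 0 < j by omega)
    -- on the block, `f p = p^{-1} p^{-ε} ≤ (1/p) r^j`
    have hpt : ∀ p ∈ PrimeReciprocal.blockPrimes j, f p ≤ r ^ j * (1 / (p : ℝ)) := by
      intro p hp
      obtain ⟨⟨hp1, -⟩, hpp⟩ := PrimeReciprocal.mem_blockPrimes.1 hp
      have hp0 : (0 : ℝ) < p := by exact_mod_cast hpp.pos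
      have hf' : f p = (p : ℝ) ^ (-(1 + ε)) := by simp [hf, hpp]
      rw [hf', Real.rpow_def_of_pos hp0,
        show Real.log p * -(1 + ε) = -(ε * Real.log p) + -Real.log p by ring, Real.exp_add,
        Real.exp_neg (Real.log p), Real.exp_log hp0, ← one_div]
      refine mul_le_mul_of_nonneg_right ?_ (by positivity)
      -- `exp(-ε log p) ≤ exp(-ε log 2^j) = r^j`
      rw [hr, ← Real.exp_nat_mul, Real.exp_le_exp]
      have hlogp : (j : ℝ) * Real.log 2 ≤ Real.log p := by
        rw [← Real.log_pow]
        exact Real.log_le_log (by positivity) (by exact_mod_cast hp1.le)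
      nlinarith
    calc ∑ p ∈ PrimeReciprocal.blockPrimes j, f p
        ≤ ∑ p ∈ PrimeReciprocal.blockPrimes j, r ^ j * (1 / (p : ℝ)) := Finset.sum_le_sum hpt
      _ = r ^ j * ∑ p ∈ PrimeReciprocal.blockPrimes j, (1 : ℝ) / p := by rw [Finset.mul_sum]
      _ ≤ r ^ j * (4 / j) :=
          mul_le_mul_of_nonneg_left (PrimeReciprocal.sum_blockPrimes_inv_le hj1) (pow_nonneg hr0 j)
      _ ≤ r ^ j * (4 / J) := by
          refine mul_le_mul_of_nonneg_left ?_ (pow_nonneg hr0 j)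
          exact div_le_div_of_nonneg_left (by norm_num) (by exact_mod_cast (show 0 < J by omega))
            (by exact_mod_cast hJj)
      _ = (4 / J) * r ^ j := mul_comm _ _
  have step2 : ∑ j ∈ Finset.Ico J B, ∑ p ∈ PrimeReciprocal.blockPrimes j, f p ≤
      (4 / J) * (1 / (1 - r)) := by
    calc ∑ j ∈ Finset.Ico J B, ∑ p ∈ PrimeReciprocal.blockPrimes j, f p
        ≤ ∑ j ∈ Finset.Ico J B, (4 / J) * r ^ j := Finset.sum_le_sum hblock
      _ = (4 / J) * ∑ j ∈ Finset.Ico J B, r ^ j := by rw [Finset.mul_sum]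
      _ ≤ (4 / J) * (r ^ J / (1 - r)) :=
          mul_le_mul_of_nonneg_left (geom_sum_Ico_le_of_lt_one hr0 hr1) (by positivity)
      _ ≤ (4 / J) * (1 / (1 - r)) := by
          refine mul_le_mul_of_nonneg_left ?_ (by positivity)
          exact div_le_div_of_nonneg_right (pow_le_one₀ hr0 hr1.le) (by linarith)
  -- `1 - r ≥ ε log 2 / 2` and `J ≥ (4/5) log M / log 2`
  have h1r : ε * Real.log 2 / 2 ≤ 1 - r :=
    PrimeReciprocal.half_le_one_sub_exp_neg (mul_pos hε0 hlog2).le hεlog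
  have hJlog : Real.log M < (J + 1) * Real.log 2 := by
    have : (M : ℝ) < (2 : ℝ) ^ (J + 1) := by exact_mod_cast hM2J
    have h := Real.log_lt_log hM0 this
    rwa [Real.log_pow, Nat.cast_add, Nat.cast_one] at h
  have hJ4' : (4 : ℝ) ≤ J := by exact_mod_cast hJ4
  have hJpos : (0 : ℝ) < J := by linarith
  have hfinal : (4 / (J : ℝ)) * (1 / (1 - r)) ≤ 16 := by
    rw [div_mul_div_comm, div_le_iff₀ (mul_pos hJpos (by linarith)), hε] at *
    -- `4 ≤ 16 J (1 - r)` with `1 - r ≥ log 2/(2 log M)` and `J log 2 ≥ (4/5) log M`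
    have h1 : Real.log 2 / (2 * Real.log M) ≤ 1 - r := by
      have : 1 / Real.log M * Real.log 2 / 2 = Real.log 2 / (2 * Real.log M) := by
        field_simp
      linarith [h1r]
    have h2 : 4 * Real.log M ≤ 5 * (J * Real.log 2) := by nlinarith
    have h3 : 16 * (J : ℝ) * (Real.log 2 / (2 * Real.log M)) ≤ 16 * J * (1 - r) :=
      mul_le_mul_of_nonneg_left h1 (by positivity)
    have h4 : (4 : ℝ) * 1 ≤ 16 * J * (Real.log 2 / (2 * Real.log M)) := by
      rw [show 16 * (J : ℝ) * (Real.log 2 / (2 * Real.log M)) = 8 * (J * Real.log 2) / Real.log M by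
        field_simp; ring]
      rw [le_div_iff₀ hlogM]
      nlinarith
    linarith
  linarith [step1, step2, hfinal]

/-- Tail of the prime sum as a `tsum`: for `M ≥ 16`,
`∑_{p ≥ M} p^{−1−1/log M} ≤ 16`. [folklore] -/
theorem tsum_tail_prime_rpow_le {M : ℕ} (hM : 16 ≤ M) :
    ∑' n : ℕ, (if (n + M).Prime then ((n + M : ℕ) : ℝ) ^ (-(1 + 1 / Real.log M)) else 0) ≤ 16 := by
  refine Real.tsum_le_of_sum_range_le (fun n => ?_) (fun k => ?_)
  · split_ifs
    · exact Real.rpow_nonneg (Nat.cast_nonneg _) _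
    · exact le_rfl
  · have := sum_Ico_prime_rpow_le hM (M + k)
    rw [Finset.sum_filter] at this
    rw [Finset.range_eq_Ico, Finset.sum_Ico_add' (fun n : ℕ =>
      (if n.Prime then ((n : ℕ) : ℝ) ^ (-(1 + 1 / Real.log M)) else 0)) 0 k M, zero_add, add_comm]
    exact this

/-- Summability of the shifted tail weights. [folklore] -/
theorem summable_tail_prime_rpow (M : ℕ) {u : ℝ} (hu : 1 < u) :
    Summable fun n : ℕ => (if (n + M).Prime then ((n + M : ℕ) : ℝ) ^ (-u) else 0) := by
  have h1 : Summable fun n : ℕ => ((n + M : ℕ) : ℝ) ^ (-u) :=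
    (summable_nat_add_iff (f := fun n : ℕ => (n : ℝ) ^ (-u)) M).2
      (Real.summable_nat_rpow.2 (by linarith))
  refine Summable.of_nonneg_of_le (fun n => ?_) (fun n => ?_) h1
  · split_ifs
    · exact Real.rpow_nonneg (Nat.cast_nonneg _) _
    · exact le_rfl
  · split_ifs
    · exact le_rfl
    · exact Real.rpow_nonneg (Nat.cast_nonneg _) _

/-! ### D. The truncated-product bound -/

/-- `16 ≤ e^8` (indeed `e^8 > 2980`). [folklore] -/
theorem sixteen_le_exp_eight : (16 : ℝ) ≤ Real.exp 8 := by
  have h1 : (2 : ℝ) ≤ Real.exp 1 := by have := Real.add_one_le_exp (1 : ℝ); linarith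
  have h : Real.exp 8 = (Real.exp 1) ^ 8 := by rw [← Real.exp_nat_mul]; norm_num
  rw [h]
  calc (16 : ℝ) ≤ 2 ^ 8 := by norm_num
    _ ≤ (Real.exp 1) ^ 8 := by gcongr

/-- **Truncated Euler product versus `L(1, χ)` (one-sided, unconditional, uniform).** There is an
absolute constant `C` such that for every modulus `q`, every non-principal character `χ` mod `q`,
every `0 < τ ≤ 1` and every natural number `M ≥ e^8` with `M ≥ q^τ`,
`∏_{p < M} (1 − Re χ(p)/p) ≤ e^{C/τ} / |L(1, χ)|`.
For real `χ` this is `∏_{p < M}(1 − χ(p)/p) ≪_τ L(1, χ)⁻¹`, the estimate behind (1.4) of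
Granville–Mollin (their (5.3)–(5.4), where it is derived from the explicit formula; the possible
Siegel zero only improves the inequality). Proof: `log ∏ ≤ −∑_{p<M} Re χ(p)/p`; compare with
`−∑_p Re χ(p)p^{−u}`, `u = 1 + 1/log M`, at the cost of the head (`≤ 2`, Mertens) and the tail
(`≤ 16`, Chebyshev); `−∑_p Re χ(p) p^{−u} ≤ −log|L(u, χ)| + 2` (Euler product); and
`−log|L(u, χ)| ≤ −log|L(1, χ)| + E(log q + log 4)/log M ≤ −log|L(1, χ)| + 3E/τ`
(`exists_norm_LFunction_one_le`). [cite: GranvilleMollin2000, §5B–5C, (5.3)–(5.4)] -/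
theorem exists_prod_one_sub_re_div_le :
    ∃ C : ℝ, 0 ≤ C ∧ ∀ (q : ℕ) [NeZero q] (χ : DirichletCharacter ℂ q), χ ≠ 1 →
      ∀ τ : ℝ, 0 < τ → τ ≤ 1 → ∀ M : ℕ, Real.exp 8 ≤ (M : ℝ) → (q : ℝ) ^ τ ≤ (M : ℝ) →
        ∏ p ∈ Nat.primesBelow M, (1 - (χ p).re / p) ≤ Real.exp (C / τ) / ‖χ.LFunction 1‖ := by
  obtain ⟨E, hE, hB⟩ := exists_norm_LFunction_one_le
  refine ⟨3 * E + 20, by positivity, fun q _ χ hχ τ hτ hτ1 M hM8 hMq => ?_⟩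
  -- sizes
  have hq1 : q ≠ 1 := by
    rintro rfl; exact hχ (DirichletCharacter.level_one χ)
  have hq2 : (2 : ℝ) ≤ q := by
    have : 2 ≤ q := by have := NeZero.ne q; omega
    exact_mod_cast this
  have hlogq : 0 < Real.log q := Real.log_pos (by linarith)
  have hl2 : (0.6931471803 : ℝ) < Real.log 2 := Real.log_two_gt_d9
  have hM16r : (16 : ℝ) ≤ M := sixteen_le_exp_eight.trans hM8
  have hM16 : 16 ≤ M := by exact_mod_cast hM16r
  have hM2 : 2 ≤ M := by omega
  have hM0 : (0 : ℝ) < M := by linarith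
  have hlogM8 : 8 ≤ Real.log M := by
    rw [Real.le_log_iff_exp_le hM0]; exact hM8
  have hlogM : 0 < Real.log M := by linarith
  have hlogMq : τ * Real.log q ≤ Real.log M := by
    rw [← Real.log_rpow (by linarith)]
    exact Real.log_le_log (Real.rpow_pos_of_pos (by linarith) τ) hMq
  set ε : ℝ := 1 / Real.log M with hε
  have hε0 : 0 < ε := by positivity
  have hε8 : ε ≤ 1 / 8 := by
    rw [hε]; exact one_div_le_one_div_of_le (by norm_num) hlogM8
  set u : ℝ := 1 + ε with hu
  have hu1 : 1 < u := by rw [hu]; linarith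
  have hu98 : u ≤ 9 / 8 := by rw [hu]; linarith
  -- D1: `log ∏ ≤ -∑ Re χ(p)/p`
  set P : ℝ := ∏ p ∈ Nat.primesBelow M, (1 - (χ p).re / p) with hP
  have hfac : ∀ p ∈ Nat.primesBelow M, 0 < 1 - (χ p).re / p := by
    intro p hp
    have hp2 : (2 : ℝ) ≤ p := by exact_mod_cast (Nat.mem_primesBelow.1 hp).2.two_le
    have h1 : |(χ p).re| ≤ 1 := (Complex.abs_re_le_norm _).trans (DirichletCharacter.norm_le_one χ _)
    rw [abs_le] at h1
    have : (χ p).re / p ≤ 1 / 2 := by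
      rw [div_le_iff₀ (by linarith)]; linarith
    linarith
  have hPpos : 0 < P := Finset.prod_pos hfac
  have hD1 : Real.log P ≤ -∑ p ∈ Nat.primesBelow M, (χ p).re / p := by
    rw [hP, Real.log_prod (fun p hp => (hfac p hp).ne'), ← Finset.sum_neg_distrib]
    refine Finset.sum_le_sum fun p hp => ?_
    have := Real.log_le_sub_one_of_pos (hfac p hp)
    linarith
  -- D2: head
  have hD2 : -∑ p ∈ Nat.primesBelow M, (χ p).re / p ≤
      -∑ p ∈ Nat.primesBelow M, (χ p).re * (p : ℝ) ^ (-u) + 2 := by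
    have hhead := sum_primesBelow_inv_sub_rpow_le hM2
    have hlog4 : Real.log 4 / Real.log M ≤ 1 := by
      rw [div_le_one hlogM]
      have : Real.log 4 = 2 * Real.log 2 := by
        rw [show (4 : ℝ) = 2 ^ 2 by norm_num, Real.log_pow]; norm_num
      have hl2' : Real.log 2 < 0.6931471808 := Real.log_two_lt_d9
      linarith
    have hterm : ∀ p ∈ Nat.primesBelow M,
        -((χ p).re / p) ≤ -((χ p).re * (p : ℝ) ^ (-u)) + (1 / (p : ℝ) - (p : ℝ) ^ (-(1 + 1 / Real.log M))) := by
      intro p hp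
      have hp1 : (1 : ℝ) ≤ p := by exact_mod_cast (Nat.mem_primesBelow.1 hp).2.one_lt.le
      have h1 : |(χ p).re| ≤ 1 := (Complex.abs_re_le_norm _).trans (DirichletCharacter.norm_le_one χ _)
      rw [abs_le] at h1
      have hu' : -(1 + 1 / Real.log M) = -u := by rw [hu, hε]
      rw [hu']
      have hge : (p : ℝ) ^ (-u) ≤ 1 / p := by
        rw [one_div, ← Real.rpow_neg_one]
        exact Real.rpow_le_rpow_of_exponent_le hp1 (by linarith)
      have hnn : 0 ≤ (p : ℝ) ^ (-u) := Real.rpow_nonneg (by linarith) _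
      have : (χ p).re / p = (χ p).re * (1 / p) := by ring
      rw [this]
      nlinarith
    have := Finset.sum_le_sum hterm
    rw [Finset.sum_add_distrib, Finset.sum_neg_distrib, Finset.sum_neg_distrib] at this
    linarith
  -- D3: the finite sum versus the sum over all primes (tail)
  set G : ℕ → ℝ := fun n => (χ n).re * (n : ℝ) ^ (-u) with hG
  set g : ℕ → ℝ := fun n => if n.Prime then G n else 0 with hg
  have hGbound : ∀ n : ℕ, |G n| ≤ (n : ℝ) ^ (-u) := by
    intro n
    rw [hG, abs_mul, abs_of_nonneg (Real.rpow_nonneg (Nat.cast_nonneg n) _)]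
    exact mul_le_of_le_one_left (Real.rpow_nonneg (Nat.cast_nonneg n) _)
      ((Complex.abs_re_le_norm _).trans (DirichletCharacter.norm_le_one χ _))
  have hGs : Summable (G ∘ ((↑) : {p : ℕ | p.Prime} → ℕ)) := by
    refine Summable.of_norm_bounded (g := fun p : Nat.Primes => ((p : ℕ) : ℝ) ^ (-u))
      (Nat.Primes.summable_rpow.2 (by linarith)) fun p => ?_
    rw [Real.norm_eq_abs]
    exact hGbound p
  have hg_ind : g = {p : ℕ | p.Prime}.indicator G := by
    funext n
    simp only [hg, Set.indicator_apply, Set.mem_setOf_eq]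
  have hgs : Summable g := by rw [hg_ind]; exact summable_subtype_iff_indicator.1 hGs
  have hsplit : ∑ p ∈ Nat.primesBelow M, (χ p).re * (p : ℝ) ^ (-u) + ∑' n, g (n + M) = ∑' n, g n := by
    rw [← Summable.sum_add_tsum_nat_add M hgs]
    congr 1
    rw [Nat.primesBelow, Finset.sum_filter]
  have htail : ∑' n, g (n + M) ≤ 16 := by
    have ht := tsum_tail_prime_rpow_le hM16
    have hu' : -(1 + 1 / Real.log M) = -u := by rw [hu, hε]
    rw [hu'] at ht
    set t : ℕ → ℝ := fun n => if (n + M).Prime then ((n + M : ℕ) : ℝ) ^ (-u) else 0 with ht_def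
    have hts : Summable t := summable_tail_prime_rpow M hu1
    have hgs' : Summable fun n => g (n + M) := (summable_nat_add_iff M).2 hgs
    have hle : ∀ n, g (n + M) ≤ t n := by
      intro n
      simp only [hg, ht_def]
      split_ifs with h
      · have := hGbound (n + M)
        rw [abs_le] at this
        exact this.2
      · exact le_rfl
    exact (Summable.tsum_le_tsum hle hgs' hts).trans ht
  have hD3 : -∑ p ∈ Nat.primesBelow M, (χ p).re * (p : ℝ) ^ (-u) ≤ -∑' n, g n + 16 := by
    linarith [hsplit, htail]
  -- D4: Euler product
  have hT : ∑' n, g n = ∑' p : Nat.Primes, (χ p * (p : ℂ) ^ (-(u : ℂ))).re := by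
    rw [hg_ind, ← _root_.tsum_subtype]
    refine tsum_congr fun p => ?_
    rw [hG]
    simp only
    rw [show (((p : ℕ) : ℂ) ^ (-(u : ℂ))) = ((((p : ℕ) : ℝ) ^ (-u) : ℝ) : ℂ) by
      rw [Complex.ofReal_cpow (Nat.cast_nonneg _), Complex.ofReal_neg, Complex.ofReal_natCast],
      Complex.re_mul_ofReal]
  have hD4 : -∑' n, g n ≤ -Real.log ‖χ.LFunction (u : ℂ)‖ + 2 := by
    have := log_norm_LFunction_le_tsum_re χ hu1
    rw [← hT] at this
    linarith
  -- D5: from `u` to `1`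
  have hL1 : 0 < ‖χ.LFunction 1‖ := norm_pos_iff.2 (DirichletCharacter.LFunction_apply_one_ne_zero hχ)
  have hLu : 0 < ‖χ.LFunction (u : ℂ)‖ :=
    norm_pos_iff.2 (DirichletCharacter.LFunction_ne_zero_of_one_le_re χ (Or.inl hχ) (by simp; linarith))
  have hD5 : -Real.log ‖χ.LFunction (u : ℂ)‖ ≤
      -Real.log ‖χ.LFunction 1‖ + E * (Real.log q + Real.log 4) * ε := by
    have h := hB q χ hχ u hu1.le hu98
    have h' := Real.log_le_log hL1 h
    rw [Real.log_mul hLu.ne' (Real.exp_pos _).ne', Real.log_exp, show u - 1 = ε by rw [hu]; ring] at h'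
    linarith
  -- D6: `E ℒ ε ≤ 3E/τ`
  have hD6 : E * (Real.log q + Real.log 4) * ε ≤ 3 * E / τ := by
    have hlog4 : Real.log 4 = 2 * Real.log 2 := by
      rw [show (4 : ℝ) = 2 ^ 2 by norm_num, Real.log_pow]; norm_num
    have hlog2q : Real.log 2 ≤ Real.log q := Real.log_le_log two_pos hq2
    -- `(log q + log 4) ε ≤ (log q + log 4)/(τ log q) ≤ 3/τ`
    have h1 : (Real.log q + Real.log 4) * ε ≤ (Real.log q + Real.log 4) / (τ * Real.log q) := by
      rw [hε, ← div_eq_mul_one_div]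
      exact div_le_div_of_nonneg_left (by linarith) (mul_pos hτ hlogq) hlogMq
    have h2 : (Real.log q + Real.log 4) / (τ * Real.log q) ≤ 3 / τ := by
      rw [div_le_div_iff₀ (mul_pos hτ hlogq) hτ]
      nlinarith
    calc E * (Real.log q + Real.log 4) * ε = E * ((Real.log q + Real.log 4) * ε) := by ring
      _ ≤ E * (3 / τ) := mul_le_mul_of_nonneg_left (h1.trans h2) hE
      _ = 3 * E / τ := by ring
  -- assemble
  have h20 : (20 : ℝ) ≤ 20 / τ := by
    rw [le_div_iff₀ hτ]; nlinarith
  have hlogP : Real.log P ≤ -Real.log ‖χ.LFunction 1‖ + (3 * E + 20) / τ := by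
    have : (3 * E + 20) / τ = 3 * E / τ + 20 / τ := by ring
    linarith [hD1, hD2, hD3, hD4, hD5, hD6]
  calc P = Real.exp (Real.log P) := (Real.exp_log hPpos).symm
    _ ≤ Real.exp (-Real.log ‖χ.LFunction 1‖ + (3 * E + 20) / τ) := Real.exp_le_exp.2 hlogP
    _ = Real.exp ((3 * E + 20) / τ) / ‖χ.LFunction 1‖ := by
        rw [Real.exp_add, Real.exp_neg, Real.exp_log hL1]; ring

end Literature.NumberTheory.LFunctions.DirichletLOne
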